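import Summits.PneNP.PneNP.Theses.UncheckableSAT
import Summits.PneNP.PneNP.Theorems.UncheckableSATAssembly
import Literature.Computability.Complexity.MCSPHardnessKabanetsCaiProofs
import Literature.Computability.Complexity.AdaptiveFunctions
import Literature.Computability.Complexity.BakerGillSolovay
import Literature.Computability.Complexity.CookLevinSAT
import Literature.Computability.Complexity.OracleProofs
import Literature.Computability.Complexity.OracleClosure
import Literature.Computability.Complexity.OracleComposition
import Literature.Computability.Complexity.OracleCompositionMachine
import Literature.Computability.Complexity.BPClosureProofs
import Literature.Computability.Complexity.NegCNFTranscoder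
import Literature.Computability.Complexity.PRelHierarchy
import Literature.Computability.Complexity.PlumbingBricks
import Literature.Computability.Complexity.CodeFPArith
import Literature.Computability.Complexity.CodeFPLists

/-!
# Route UncheckableSAT — `ThesisImpliesNPneCoNP` (stmt-PneNP-2305)

`X ⇒ NP ≠ coNP`, by contraposition: if `NP = coNP` then `UNSAT = SATᶜ ∩ {CNF codes}` has an `NP`
certificate relation `V` with length bound `p`, and `UNSAT` gets a competitive interactive proof in the
route's template:

* verifier: no coins, message length `p(|x|)`, constant next-message `[]`; verdict (in `P`, one typed
  `CodeFP` program on the view `⟨x, ⟨r, enc (a₁, a₂, …)⟩⟩`): for `|x| ≤ 1` (fewer than two messages are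
  exchanged) a hard-wired table of the three short strings, for `|x| ≥ 2` "some prefix `u` of the
  prover's first message `a₂` with `|u| ≤ p(|x|)` has `⟨x, u⟩ ∈ V`";
* honest prover `M = W ∘ fst ∈ FP^SAT`, where `W` is the bit-by-bit prefix search
  (`AdQuery.adFn` with the Kabanets–Cai query generator `qry`) for a full-length string of the
  exact-length relation `R = {⟨x, s⟩ : |s| = p(|x|), some prefix of s is a V-certificate}` against the
  `NP` oracle `PrefExt R p`, moved to a `SAT` oracle by Cook–Levin (`SAT_isNPHard_holds`) and
  `FP^{FP^SAT} ⊆ FP^SAT`;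
* completeness `1` (the padded search result keeps its certificate prefix), soundness `0` (acceptance
  exhibits a certificate).
-/

set_option linter.dupNamespace false -- `Summit.PneNP.PneNP.…`: summit = sub-problem name (D-0017 single-conjunct layout)

namespace Summit.PneNP.PneNP.Theorems

open _root_.Computability Polynomial
open Literature.Computability.Complexity Literature.Computability.Complexity.CodeFP
  Literature.Computability.Complexity.Brick

/-- The prefix-certificate condition "some prefix `u` of `a` with `|u| ≤ p(|x|)` has `⟨x, u⟩ ∈ V`", read off
the finitely many prefixes. [folklore] -/
theorem thesisNPcoNP_prefix_iff (V : Language Bool) (p : Polynomial ℕ) (x a : List Bool) :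
    ((∃ i, i < a.length ∧ i ≤ p.eval x.length ∧ boolPair x (a.take (min i a.length)) ∈ V) ∨
        (a.length ≤ p.eval x.length ∧ boolPair x a ∈ V)) ↔
      ∃ u, u <+: a ∧ u.length ≤ p.eval x.length ∧ boolPair x u ∈ V := by
  constructor
  · rintro (⟨i, hi, hip, hiV⟩ | ⟨ha, haV⟩)
    · rw [min_eq_left hi.le] at hiV
      exact ⟨a.take i, List.take_prefix _ _, by rw [List.length_take, min_eq_left hi.le]; exact hip, hiV⟩
    · exact ⟨a, List.prefix_rfl, ha, haV⟩
  · rintro ⟨u, hu, hup, huV⟩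
    by_cases h : u.length < a.length
    · left
      refine ⟨u.length, h, hup, ?_⟩
      rw [min_eq_left h.le, ← List.prefix_iff_eq_take.1 hu]
      exact huV
    · right
      obtain rfl : u = a := hu.eq_of_length (le_antisymm hu.length_le (not_lt.1 h))
      exact ⟨hup, huV⟩

/-- **The prefix-certificate test as a typed program** on `(x, a)`. [cite: AroraBarak2009, §1.3] [folklore] -/
theorem thesisNPcoNP_exists_prefixTest {V : Language Bool} (hV : V ∈ Classes.P) (p : Polynomial ℕ) :
    ∃ τ : List Bool × List Bool → Bool, CodeFP (pairE strE strE) bitE τ ∧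
      ∀ x a, τ (x, a) = true ↔ ∃ u, u <+: a ∧ u.length ≤ p.eval x.length ∧ boolPair x u ∈ V := by
  have hVi : CodeFP (pairE strE strE) bitE fun c : List Bool × List Bool => V.boolIndicator (boolPair c.1 c.2) :=
    CodeFP.of_fn _ (indicatorFn_mem_FP hV) fun _ => rfl
  have hpU : CodeFP strE unE fun x : List Bool => p.eval x.length :=
    CodeFP.of_fn (Plumb.polyFn p) (Plumb.polyFn_mem_FP p) fun x => by
      rw [Plumb.polyFn_apply, unE_eq_ones]; rfl
  have hpN : CodeFP strE natE fun x : List Bool => p.eval x.length := (natOfUn.comp hpU :)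
  have cx : CodeFP (pairE strE strE) strE fun c : List Bool × List Bool => c.1 := CodeFP.fst _ _
  have ca : CodeFP (pairE strE strE) strE fun c : List Bool × List Bool => c.2 := CodeFP.snd _ _
  have caU : CodeFP (pairE strE strE) unE fun c : List Bool × List Bool => c.2.length := (strLength.comp ca :)
  have caN : CodeFP (pairE strE strE) natE fun c : List Bool × List Bool => c.2.length := (natOfUn.comp caU :)
  have cpN : CodeFP (pairE strE strE) natE fun c : List Bool × List Bool => p.eval c.1.length := (hpN.comp cx :)
  have cR : CodeFP (pairE strE strE) (rawE natE) fun c : List Bool × List Bool =>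
      List.range (min c.2.length c.2.length) := (rangeOf.comp (caU.pair caN) :)
  -- inner predicate on `((x, a), i)`
  have dx : CodeFP (pairE (pairE strE strE) natE) strE fun d : (List Bool × List Bool) × ℕ => d.1.1 :=
    (CodeFP.fst _ _).fst'
  have da : CodeFP (pairE (pairE strE strE) natE) strE fun d : (List Bool × List Bool) × ℕ => d.1.2 :=
    (CodeFP.fst _ _).snd'
  have di : CodeFP (pairE (pairE strE strE) natE) natE fun d : (List Bool × List Bool) × ℕ => d.2 :=
    CodeFP.snd _ _
  have daU : CodeFP (pairE (pairE strE strE) natE) unE fun d : (List Bool × List Bool) × ℕ => d.1.2.length :=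
    (strLength.comp da :)
  have dmin : CodeFP (pairE (pairE strE strE) natE) unE fun d : (List Bool × List Bool) × ℕ =>
      min d.2 d.1.2.length := (unOfNatMin.comp (daU.pair di) :)
  have dtake : CodeFP (pairE (pairE strE strE) natE) strE fun d : (List Bool × List Bool) × ℕ =>
      d.1.2.take (min d.2 d.1.2.length) := (strTake.comp (dmin.pair da) :)
  have dV : CodeFP (pairE (pairE strE strE) natE) bitE fun d : (List Bool × List Bool) × ℕ =>
      V.boolIndicator (boolPair d.1.1 (d.1.2.take (min d.2 d.1.2.length))) := (hVi.comp (dx.pair dtake) :)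
  have dle : CodeFP (pairE (pairE strE strE) natE) bitE fun d : (List Bool × List Bool) × ℕ =>
      decide (d.2 ≤ p.eval d.1.1.length) := (natLe.comp (di.pair (hpN.comp dx)) :)
  have dP : CodeFP (pairE (pairE strE strE) natE) bitE fun d : (List Bool × List Bool) × ℕ =>
      decide (d.2 ≤ p.eval d.1.1.length) &&
        V.boolIndicator (boolPair d.1.1 (d.1.2.take (min d.2 d.1.2.length))) := dle.and dV
  have cany : CodeFP (pairE strE strE) bitE fun c : List Bool × List Bool =>
      (List.range (min c.2.length c.2.length)).any fun i =>
        decide (i ≤ p.eval c.1.length) && V.boolIndicator (boolPair c.1 (c.2.take (min i c.2.length))) :=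
    ((CodeFP.any dP).comp ((CodeFP.id _).pair cR) :)
  have cle : CodeFP (pairE strE strE) bitE fun c : List Bool × List Bool =>
      decide (c.2.length ≤ p.eval c.1.length) := (natLe.comp (caN.pair cpN) :)
  have cfull : CodeFP (pairE strE strE) bitE fun c : List Bool × List Bool =>
      decide (c.2.length ≤ p.eval c.1.length) && V.boolIndicator (boolPair c.1 c.2) := cle.and hVi
  refine ⟨_, cany.or cfull, fun x a => ?_⟩
  rw [← thesisNPcoNP_prefix_iff V p x a]
  simp only [Bool.or_eq_true, List.any_eq_true, List.mem_range, Bool.and_eq_true, decide_eq_true_eq,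
    min_self, ← Set.mem_iff_boolIndicator]
  constructor
  · rintro (⟨i, hi, hip, hiV⟩ | h)
    · exact Or.inl ⟨i, hi, hip, hiV⟩
    · exact Or.inr h
  · rintro (⟨i, hi, hip, hiV⟩ | h)
    · exact Or.inl ⟨i, hi, hip, hiV⟩
    · exact Or.inr h

/-- **The exact-length certificate relation** `R = {⟨x, s⟩ : |s| = p(|x|) ∧ some prefix u of s with
|u| ≤ p(|x|) has ⟨x, u⟩ ∈ V}` is in `P`. [cite: AroraBarakCC2009, Thm. 2.18] [folklore] -/
theorem thesisNPcoNP_exists_rel {V : Language Bool} (hV : V ∈ Classes.P) (p : Polynomial ℕ) :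
    ∃ R : Language Bool, R ∈ Classes.P ∧ ∀ x s, boolPair x s ∈ R ↔
      s.length = p.eval x.length ∧ ∃ u, u <+: s ∧ u.length ≤ p.eval x.length ∧ boolPair x u ∈ V := by
  obtain ⟨τ, hτ, hτspec⟩ := thesisNPcoNP_exists_prefixTest hV p
  have hpU : CodeFP strE unE fun x : List Bool => p.eval x.length :=
    CodeFP.of_fn (Plumb.polyFn p) (Plumb.polyFn_mem_FP p) fun x => by
      rw [Plumb.polyFn_apply, unE_eq_ones]; rfl
  have cpN : CodeFP (pairE strE strE) natE fun c : List Bool × List Bool => p.eval c.1.length :=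
    ((natOfUn.comp hpU).comp (CodeFP.fst _ _) :)
  have caN : CodeFP (pairE strE strE) natE fun c : List Bool × List Bool => c.2.length :=
    (natOfUn.comp (strLength.comp (CodeFP.snd _ _)) :)
  have hlen : CodeFP (pairE strE strE) bitE fun c : List Bool × List Bool =>
      decide (c.2.length = p.eval c.1.length) := (natEq.comp (caN.pair cpN) :)
  obtain ⟨g, hg, hgspec⟩ := hlen.and hτ
  refine ⟨g ⁻¹' PRelSigma.HeadIs true, preimage_mem_P (PRelSigma.HeadIs_mem_P true) hg, fun x s => ?_⟩
  change (g (pairE strE strE (x, s))).head? = some true ↔ _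
  rw [hgspec]
  simp only [bitE, List.head?_cons, Option.some.injEq, Bool.and_eq_true, decide_eq_true_eq]
  rw [hτspec]

/-- **Bit-by-bit prefix search with a `SAT` oracle**: for an exact-length `P` relation `R`
(`⟨x, s⟩ ∈ R ⇒ |s| = p(|x|)`) there is `W ∈ FP^SAT` with `⟨x, W x⟩ ∈ R` whenever `x` has any
`R`-partner — the answer bits of the adaptive queries "does the prefix extended by `1` extend to an
`R`-partner?" to the `NP` language `PrefExt R p`, which Cook–Levin reduces to `SAT`.
[cite: AroraBarakCC2009, Thm. 2.18] [cite: BellareGoldwasser1994, §1] -/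
theorem thesisNPcoNP_exists_search {R : Language Bool} (hR : R ∈ Classes.P) (p : Polynomial ℕ)
    (hlen : ∀ x s, boolPair x s ∈ R → s.length = p.eval x.length) :
    ∃ W : List Bool → List Bool, W ∈ FPRel (Oracle.ofLanguage SAT) ∧
      ∀ x, (∃ s, boolPair x s ∈ R) → boolPair x (W x) ∈ R := by
  set A : Language Bool := KabanetsCai.PrefExt R p with hA
  -- invariant of the search: the answer prefix extends to an `R`-partner
  have hinv : ∀ x, (∃ s, boolPair x s ∈ R) → ∀ i, i ≤ p.eval x.length →
      ∃ v, boolPair x (AdQuery.adBits KabanetsCai.qry A x i ++ v) ∈ R := by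
    intro x hex i
    induction i with
    | zero => intro; simpa [AdQuery.adBits] using hex
    | succ i ih =>
      intro hi
      obtain ⟨v, hv⟩ := ih (Nat.le_of_succ_le hi)
      rw [AdQuery.adBits_succ, KabanetsCai.qry_boolPair]
      by_cases hmem : boolPair x (AdQuery.adBits KabanetsCai.qry A x i ++ [true]) ∈ A
      · rw [(Set.mem_iff_boolIndicator _ _).1 hmem]
        obtain ⟨v', -, hv'⟩ := (KabanetsCai.boolPair_mem_PrefExt R p x _).1 hmem
        exact ⟨v', by simpa [List.append_assoc] using hv'⟩
      · rw [(Set.notMem_iff_boolIndicator _ _).1 hmem]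
        match v, hv with
        | [], hv =>
          have hl := hlen x _ hv
          rw [List.append_nil, AdQuery.length_adBits] at hl
          omega
        | false :: v', hv => exact ⟨v', by simpa [List.append_assoc] using hv⟩
        | true :: v', hv =>
          exfalso
          apply hmem
          rw [hA, KabanetsCai.boolPair_mem_PrefExt]
          have hl := hlen x _ hv
          refine ⟨v', ?_, by simpa [List.append_assoc] using hv⟩
          rw [← hl]
          simp [List.append_assoc]
  have hfull : ∀ x, (∃ s, boolPair x s ∈ R) →
      boolPair x (AdQuery.adBits KabanetsCai.qry A x (p.eval x.length)) ∈ R := by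
    intro x hex
    obtain ⟨v, hv⟩ := hinv x hex _ le_rfl
    have hl := hlen x _ hv
    rw [List.length_append, AdQuery.length_adBits] at hl
    obtain rfl : v = [] := List.eq_nil_of_length_eq_zero (by omega)
    simpa using hv
  refine ⟨AdQuery.adFn KabanetsCai.qry p sndF A, ?_, fun x hex => ?_⟩
  · have hW : AdQuery.adFn KabanetsCai.qry p sndF A ∈ FPRel (Oracle.ofLanguage A) :=
      AdQuery.adFn_mem_FPRel KabanetsCai.qry_mem_FP sndF_mem_FP A
    have hANP : A ∈ Nondeterministic.NP := KabanetsCai.PrefExt_mem_NP R p hR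
    have hAP : A ∈ PRel (Oracle.ofLanguage SAT) :=
      mem_PRel_of_karpReducible ((SAT_isNPHard_iff.1 SAT_isNPHard_holds) A hANP)
        (self_mem_PRel_ofLanguage_holds SAT)
    exact OracleAlg.FPRel_subset_FPRel_of_mem_FPRel (OracleAlg.ofLanguage_mem_FPRel_of_mem_PRel hAP) hW
  · rw [AdQuery.adFn_apply, sndF_boolPair]
    exact hfull x hex

/-- The verifier's view is the typed code of `(x, (r, msgs))`. [folklore] -/
theorem thesisNPcoNP_view_eq (x r : List Bool) (msgs : List (List Bool)) :
    IPVerifier.view x r msgs = pairE strE (pairE strE (listE strE)) (x, (r, msgs)) := by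
  rw [IPVerifier.view, listE_eq]
  rfl

/-- **The verdict language** (in `P`): on the view `⟨x, ⟨r, enc msgs⟩⟩`, for `|x| ≤ 1` a hard-wired table
`b₀, b₁, b₂` of the three short strings, for `|x| ≥ 2` the prefix-certificate test on the second message.
[cite: AroraBarakCC2009, Def. 8.6] [folklore] -/
theorem thesisNPcoNP_exists_verdict {V : Language Bool} (hV : V ∈ Classes.P) (p : Polynomial ℕ)
    (b₀ b₁ b₂ : Bool) :
    ∃ D : Language Bool, D ∈ Classes.P ∧ ∀ (x r : List Bool) (msgs : List (List Bool)),
      IPVerifier.view x r msgs ∈ D ↔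
        (x.length ≤ 1 ∧ ((x = [] ∧ b₀ = true) ∨ (x = [false] ∧ b₁ = true) ∨ (x = [true] ∧ b₂ = true))) ∨
          (2 ≤ x.length ∧ ∃ u, u <+: msgs.getD 1 [] ∧ u.length ≤ p.eval x.length ∧ boolPair x u ∈ V) := by
  obtain ⟨τ, hτ, hτspec⟩ := thesisNPcoNP_exists_prefixTest hV p
  have qx : CodeFP (pairE strE (pairE strE (listE strE))) strE
      fun q : List Bool × (List Bool × List (List Bool)) => q.1 := CodeFP.fst _ _
  have qraw : CodeFP (pairE strE (pairE strE (listE strE))) (rawE strE)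
      fun q : List Bool × (List Bool × List (List Bool)) => q.2.2 := ((rawOfList strE).comp (CodeFP.snd _ _).snd' :)
  have qa : CodeFP (pairE strE (pairE strE (listE strE))) strE
      fun q : List Bool × (List Bool × List (List Bool)) => q.2.2.getD 1 [] :=
    ((rawGetD strE rfl).comp (qraw.pair (CodeFP.const _ 1)) :)
  have qn : CodeFP (pairE strE (pairE strE (listE strE))) natE
      fun q : List Bool × (List Bool × List (List Bool)) => q.1.length := (natOfUn.comp (strLength.comp qx) :)
  have qle : CodeFP (pairE strE (pairE strE (listE strE))) bitE
      fun q : List Bool × (List Bool × List (List Bool)) => decide (q.1.length ≤ 1) :=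
    (natLe.comp (qn.pair (CodeFP.const _ 1)) :)
  have qge : CodeFP (pairE strE (pairE strE (listE strE))) bitE
      fun q : List Bool × (List Bool × List (List Bool)) => decide (2 ≤ q.1.length) :=
    (natLe.comp ((CodeFP.const _ 2).pair qn) :)
  have heq : ∀ (u : List Bool) (b : Bool), CodeFP strE bitE fun x : List Bool => decide (x = u) && b := fun u b =>
    (((CodeFP.eq (eα := strE) fun _ _ h => h).comp ((CodeFP.id _).pair (CodeFP.const _ u)) :) : CodeFP strE bitE
      fun x : List Bool => decide (x = u)).and (CodeFP.const _ b)
  have hsmall : CodeFP strE bitE fun x : List Bool =>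
      (decide (x = []) && b₀) || ((decide (x = [false]) && b₁) || (decide (x = [true]) && b₂)) :=
    (heq [] b₀).or ((heq [false] b₁).or (heq [true] b₂))
  have qsmall : CodeFP (pairE strE (pairE strE (listE strE))) bitE
      fun q : List Bool × (List Bool × List (List Bool)) =>
        (decide (q.1 = []) && b₀) || ((decide (q.1 = [false]) && b₁) || (decide (q.1 = [true]) && b₂)) :=
    (hsmall.comp qx :)
  have qτ : CodeFP (pairE strE (pairE strE (listE strE))) bitE
      fun q : List Bool × (List Bool × List (List Bool)) => τ (q.1, q.2.2.getD 1 []) := (hτ.comp (qx.pair qa) :)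
  obtain ⟨g, hg, hgspec⟩ := (qle.and qsmall).or (qge.and qτ)
  refine ⟨g ⁻¹' PRelSigma.HeadIs true, preimage_mem_P (PRelSigma.HeadIs_mem_P true) hg, fun x r msgs => ?_⟩
  rw [thesisNPcoNP_view_eq]
  change (g (pairE strE (pairE strE (listE strE)) (x, (r, msgs)))).head? = some true ↔ _
  rw [hgspec]
  simp only [bitE, List.head?_cons, Option.some.injEq, Bool.or_eq_true, Bool.and_eq_true, decide_eq_true_eq]
  rw [hτspec]

/-- The first two messages of an interaction with at least two messages: `a₁ = V`'s first message and
`a₂ =` the prover's (normalised) reply to it. [cite: AroraBarakCC2009, Def. 8.6] [folklore] -/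
theorem thesisNPcoNP_transcript_two (V : IPVerifier) (k : ℕ) (x r : List Bool) (P : IPProver) :
    ∃ t, V.transcript (k + 2) x r P =
      [(V.next (IPVerifier.view x r [])).takeD (V.msgLen.eval x.length) false,
        (P [(V.next (IPVerifier.view x r [])).takeD (V.msgLen.eval x.length) false]).takeD
          (V.msgLen.eval x.length) false] ++ t := by
  have hpre : ∀ (m n : ℕ) (b : Bool) (t : List (List Bool)), ∃ t', V.transcriptAux x r P m b n t = t ++ t' := by
    intro m n
    induction n with
    | zero => intro b t; exact ⟨[], by cases b <;> simp [IPVerifier.transcriptAux]⟩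
    | succ n ih =>
      intro b t
      cases b
      · obtain ⟨t', ht'⟩ := ih true (t ++ [(P t).takeD m false])
        exact ⟨(P t).takeD m false :: t', by rw [IPVerifier.transcriptAux, ht', List.append_assoc]; rfl⟩
      · obtain ⟨t', ht'⟩ := ih false (t ++ [(V.next (IPVerifier.view x r t)).takeD m false])
        exact ⟨(V.next (IPVerifier.view x r t)).takeD m false :: t', by
          rw [IPVerifier.transcriptAux, ht', List.append_assoc]; rfl⟩
  obtain ⟨t', ht'⟩ := hpre (V.msgLen.eval x.length) k true
    [(V.next (IPVerifier.view x r [])).takeD (V.msgLen.eval x.length) false,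
      (P [(V.next (IPVerifier.view x r [])).takeD (V.msgLen.eval x.length) false]).takeD
        (V.msgLen.eval x.length) false]
  refine ⟨t', ?_⟩
  rw [← ht', IPVerifier.transcript, IPVerifier.transcriptAux, IPVerifier.transcriptAux, List.nil_append]
  rfl

/-- **stmt-PneNP-2305** `ThesisImpliesNPneCoNP`: if `UNSAT` has no competitive interactive proof with an
`FP^SAT` prover (the route's thesis), then `NP ≠ coNP` — since under `NP = coNP` the one-message
certificate protocol (prover: prefix search with a `SAT` oracle; verifier: certificate check) is such a
proof, with completeness `1` and soundness error `0`. [cite: BellareGoldwasser1994, §1]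
[cite: AroraBarakCC2009, §2.5, Def. 8.6] -/
theorem uncheckableSAT_thesisImpliesNPneCoNP_proof :
    Summit.PneNP.PneNP.Theses.UncheckableSAT.ThesisImpliesNPneCoNP := by
  unfold Summit.PneNP.PneNP.Theses.UncheckableSAT.ThesisImpliesNPneCoNP
  intro hno heq
  apply hno
  -- the certificate relation of `UNSAT` under `NP = coNP`
  have hSc : SATᶜ ∈ Nondeterministic.NP := by
    have h := compl_mem_coNP_iff.2 SAT_mem_NP_holds
    rwa [← heq] at h
  obtain ⟨V₀, hV₀, p, hp⟩ := hSc
  set Codes : Language Bool := {w | encodingCNF.encode (NegCNF.decCNF w) = w} with hCodes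
  set V : Language Bool := V₀ ⊓ (fstF ⁻¹' Codes) with hVdef
  have hVP : V ∈ Classes.P :=
    inter_mem_P hV₀ (preimage_mem_P uncheckableSAT_codes_mem_P fstF_mem_FP)
  have hchar : ∀ x, x ∈ UNSAT ↔ ∃ y, y.length ≤ p.eval x.length ∧ boolPair x y ∈ V := by
    intro x
    rw [uncheckableSAT_UNSAT_eq]
    constructor
    · rintro ⟨hxS, hxC⟩
      obtain ⟨y, hy, hyV⟩ := (hp x).1 hxS
      exact ⟨y, hy, hyV, show fstF (boolPair x y) ∈ Codes by rwa [fstF_boolPair]⟩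
    · rintro ⟨y, hy, hyV, hyC⟩
      refine ⟨(hp x).2 ⟨y, hy, hyV⟩, ?_⟩
      have h : fstF (boolPair x y) ∈ Codes := hyC
      rwa [fstF_boolPair] at h
  -- the exact-length relation, the search function, the verdict
  obtain ⟨R, hRP, hRspec⟩ := thesisNPcoNP_exists_rel hVP p
  have hRlen : ∀ x s, boolPair x s ∈ R → s.length = p.eval x.length := fun x s h => ((hRspec x s).1 h).1
  obtain ⟨W, hW, hWspec⟩ := thesisNPcoNP_exists_search hRP p hRlen
  obtain ⟨D, hDP, hD⟩ := thesisNPcoNP_exists_verdict hVP p (UNSAT.boolIndicator [])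
    (UNSAT.boolIndicator [false]) (UNSAT.boolIndicator [true])
  let Ver : IPVerifier := ⟨0, p, fun _ => [], D⟩
  have hsmall : ∀ x : List Bool, ((x = [] ∧ UNSAT.boolIndicator [] = true) ∨
      (x = [false] ∧ UNSAT.boolIndicator [false] = true) ∨ (x = [true] ∧ UNSAT.boolIndicator [true] = true)) →
      x ∈ UNSAT := by
    rintro x (⟨rfl, hb⟩ | ⟨rfl, hb⟩ | ⟨rfl, hb⟩) <;> exact (Set.mem_iff_boolIndicator _ _).2 hb
  refine ⟨Ver, 1, W ∘ fstF, ⟨const_mem_FP [], hDP⟩, comp_FP_mem_FPRel hW fstF_mem_FP,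
    fun x hx => ?_, fun x hx P => ?_⟩
  · -- completeness: every coin string accepts
    have hacc : ∀ r, Ver.Accepts (x.length ^ 1) x r
        (fun msgs => (W ∘ fstF) (boolPair x ((encodingList Bool).listBool.encode msgs))) := by
      intro r
      change IPVerifier.view x r _ ∈ D
      rw [hD]
      rcases Nat.lt_or_ge x.length 2 with hlt | hge
      · left
        refine ⟨by omega, ?_⟩
        rcases x with _ | ⟨b, _ | ⟨c, l⟩⟩
        · exact Or.inl ⟨rfl, (Set.mem_iff_boolIndicator _ _).1 hx⟩
        · cases b
          · exact Or.inr (Or.inl ⟨rfl, (Set.mem_iff_boolIndicator _ _).1 hx⟩)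
          · exact Or.inr (Or.inr ⟨rfl, (Set.mem_iff_boolIndicator _ _).1 hx⟩)
        · simp at hlt
      · right
        refine ⟨hge, ?_⟩
        obtain ⟨k, hk⟩ : ∃ k, x.length ^ 1 = k + 2 := ⟨x.length - 2, by rw [pow_one]; omega⟩
        rw [hk]
        obtain ⟨t, ht⟩ := thesisNPcoNP_transcript_two Ver k x r
          (fun msgs => (W ∘ fstF) (boolPair x ((encodingList Bool).listBool.encode msgs)))
        rw [ht]
        have hWx : boolPair x (W x) ∈ R := by
          refine hWspec x ?_
          obtain ⟨y, hy, hyV⟩ := (hchar x).1 hx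
          refine ⟨y ++ List.replicate (p.eval x.length - y.length) false, (hRspec x _).2 ⟨?_, y,
            List.prefix_append _ _, hy, hyV⟩⟩
          rw [List.length_append, List.length_replicate]
          omega
        obtain ⟨hl, u, hu, hul, huV⟩ := (hRspec x _).1 hWx
        refine ⟨u, ?_, hul, huV⟩
        change u <+: ((W ∘ fstF) (boolPair x _)).takeD (p.eval x.length) false
        rw [Function.comp_apply, fstF_boolPair, List.takeD_eq_take _ hl.ge, ← hl, List.take_length]
        exact hu
    have hset : {r | Ver.Accepts (x.length ^ 1) x r
        (fun msgs => (W ∘ fstF) (boolPair x ((encodingList Bool).listBool.encode msgs)))} = Set.univ :=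
      Set.eq_univ_of_forall hacc
    change (2 / 3 : ℝ) ≤ uniformProb _ _
    rw [hset, uniformProb_univ]
    norm_num
  · -- soundness: no coin string accepts
    have hrej : ∀ r, ¬ Ver.Accepts (x.length ^ 1) x r P := by
      intro r hacc
      rcases (hD x r _).1 hacc with ⟨-, hs⟩ | ⟨-, u, -, hul, huV⟩
      · exact hx (hsmall x hs)
      · exact hx ((hchar x).2 ⟨u, hul, huV⟩)
    have hset : {r | Ver.Accepts (x.length ^ 1) x r P} = ∅ :=
      Set.eq_empty_of_forall_notMem fun r hr => hrej r hr
    change uniformProb _ _ ≤ (1 / 3 : ℝ)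
    rw [hset, uniformProb_empty]
    norm_num

end Summit.PneNP.PneNP.Theorems
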